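import Literature.NumberTheory.Irrationality.Zudilin2014.SecondTaleDeriv

/-!
# Zudilin 2014, second tale: the partial-fraction machinery for `R̂` — the correction polynomial `Ψ = 0`

Topic `Literature/NumberTheory/Irrationality/Zudilin2014` [Zudilin2014ZetaTwo, Section 6].  For admissible
second-tale parameters (eq. (cond2)) the regular rational function `R̂(t)` of Section 6 decomposes as
[cite: Zudilin2014ZetaTwo, Section 6, display before eq. (T2)]

  `R̂(t) = Σ_{k=â₃*}^{b̂₂*−1} A_k/(t+k)² + Σ_{k=â₂*}^{b̂₃*−1} B_k/(t+k)`,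

with `A_k`, `B_k` the cover-up value and derivative of `R̂(t)(t+k)²` at `t = −k` (the tree's `coefAT`,
`coefBT` of `SecondTale.lean`).

PROVED here (0 `sorry`), by ROOT COUNTING rather than by the residue theorem: the polynomial
`Ψ = numT − Σ_{k ∈ poles} (A_k + B_k (X+k)^{μ_k−1})·dhatT_k` (`μ_k ∈ {1,2}` the pole order, `polarNum`,
`psiPoly`) has degree `≤ deg denT − 1` (`natDegree_psiPoly_le`, from the balance `Σ â = Σ b̂ − 2`) and a
root of multiplicity `μ_k` at every pole `−k` (`eval_psiPoly_eq_zero`: the value condition is the definition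
of `A_k`, resp. of `B_k` at a simple pole; `eval_derivative_psiPoly_eq_zero`: the derivative condition at a
double pole is the quotient rule defining `B_k`), hence is divisible by `denT = ∏ (X+k)^{μ_k}`
(`prod_pow_multT_eq_denT`) and vanishes: **`psiPoly_eq_zero`**.  The decomposition itself (`RT_eq_polar`)
and eq. (T4) `Σ_k B_k = 0` are read off in the companion file `SecondTalePolar.lean`.

Cell pub-zeta5 (HONEST FRAMING: systematic search; no irrationality claim unless certified).
-/

noncomputable section

open Polynomial Finset

namespace Literature.NumberTheory.Irrationality.Zudilin2014

variable {a b : Fin 4 → ℤ}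
/-! ### The pole set and the factorisation `denT = dhatT_k · (X+k)^{μ_k}` -/

/-- The pole set of `denT`: `[â₂, b̂₂) ∪ [â₃, b̂₃)`. [cite: Zudilin2014ZetaTwo, Section 6 (poles of R̂)] -/
def poleSet (a b : Fin 4 → ℤ) : Finset ℤ := Ico (a 2) (b 2) ∪ Ico (a 3) (b 3)

/-- `μ_k ≤ 2`. [cite: Zudilin2014ZetaTwo, Section 6 (poles of R̂)] -/
theorem multT_le_two (a b : Fin 4 → ℤ) (k : ℤ) : multT a b k ≤ 2 := by
  unfold multT; split_ifs <;> simp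

/-- `1 ≤ μ_k` on the pole set. [cite: Zudilin2014ZetaTwo, Section 6 (poles of R̂)] -/
theorem one_le_multT_of_mem {k : ℤ} (hk : k ∈ poleSet a b) : 1 ≤ multT a b k := by
  unfold multT; rw [poleSet, mem_union] at hk
  rcases hk with h | h
  · rw [if_pos h]; omega
  · by_cases h2 : k ∈ Ico (a 2) (b 2)
    · rw [if_pos h2]; omega
    · rw [if_neg h2, if_pos h]

/-- `μ_k = 0` off the pole set. [cite: Zudilin2014ZetaTwo, Section 6 (poles of R̂)] -/
theorem multT_eq_zero_of_not_mem {k : ℤ} (hk : k ∉ poleSet a b) : multT a b k = 0 := by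
  unfold multT; rw [poleSet, mem_union, not_or] at hk
  rw [if_neg hk.1, if_neg hk.2]

/-- **`denT = dhatT_k · (X+k)^{μ_k}`** for every `k`. [cite: Zudilin2014ZetaTwo, Section 6, eq. (T2)] -/
theorem denT_eq_dhatT_mul (a b : Fin 4 → ℤ) (k : ℤ) :
    denT a b = dhatT a b k * (X + C (k : ℚ)) ^ multT a b k := by
  unfold denT dhatT multT block
  by_cases h2 : k ∈ Ico (a 2) (b 2) <;> by_cases h3 : k ∈ Ico (a 3) (b 3)
  · rw [if_pos h2, if_pos h3, ← prod_erase_mul _ _ h2, ← prod_erase_mul _ _ h3]; ring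
  · rw [if_pos h2, if_neg h3, ← prod_erase_mul _ _ h2, erase_eq_of_notMem h3]; ring
  · rw [if_neg h2, if_pos h3, ← prod_erase_mul _ _ h3, erase_eq_of_notMem h2]; ring
  · rw [if_neg h2, if_neg h3, erase_eq_of_notMem h2, erase_eq_of_notMem h3]; ring

/-- `denT` is monic. [cite: Zudilin2014ZetaTwo, Section 6 (definition of R̂)] -/
theorem monic_denT (a b : Fin 4 → ℤ) : (denT a b).Monic := by
  unfold denT; exact (monic_block _ _).mul (monic_block _ _)

/-- `dhatT_k` is monic. [cite: Zudilin2014ZetaTwo, Section 6, eq. (T2)] -/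
theorem monic_dhatT (a b : Fin 4 → ℤ) (k : ℤ) : (dhatT a b k).Monic := by
  unfold dhatT
  exact (monic_prod_of_monic _ _ fun _ _ => monic_X_add_C _).mul
    (monic_prod_of_monic _ _ fun _ _ => monic_X_add_C _)

/-- `deg dhatT_k + μ_k = deg denT`. [cite: Zudilin2014ZetaTwo, Section 6, eq. (T2)] -/
theorem natDegree_dhatT_add (a b : Fin 4 → ℤ) (k : ℤ) :
    (dhatT a b k).natDegree + multT a b k = (denT a b).natDegree := by
  rw [denT_eq_dhatT_mul a b k, (monic_dhatT a b k).natDegree_mul ((monic_X_add_C _).pow _),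
    (monic_X_add_C _).natDegree_pow, natDegree_X_add_C, mul_one]

/-- `deg denT = (b̂₂−â₂) + (b̂₃−â₃)`. [cite: Zudilin2014ZetaTwo, Section 6 (definition of R̂)] -/
theorem natDegree_denT (a b : Fin 4 → ℤ) :
    (denT a b).natDegree = (b 2 - a 2).toNat + (b 3 - a 3).toNat := by
  unfold denT; rw [(monic_block _ _).natDegree_mul (monic_block _ _), natDegree_block, natDegree_block]

/-- `deg block2 lo hi = hi − lo` (leading coefficients `2`). [cite: Zudilin2014ZetaTwo, Section 6 (definition of R̂)] -/
theorem natDegree_block2 (lo hi : ℤ) : (block2 lo hi).natDegree = (hi - lo).toNat := by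
  unfold block2
  rw [natDegree_prod _ _ fun l _ => ?_]
  · simp_rw [show ∀ l : ℤ, (C (2 : ℚ) * X + C (l : ℚ)).natDegree = 1 from fun l => by
      rw [show C (2 : ℚ) * X + C (l : ℚ) = C (2 : ℚ) * (X + C ((l : ℚ) / 2)) by
        rw [mul_add, ← C_mul]; congr 2; ring, natDegree_C_mul (by norm_num), natDegree_X_add_C]]
    simp
  · rw [show C (2 : ℚ) * X + C (l : ℚ) = C (2 : ℚ) * (X + C ((l : ℚ) / 2)) by
        rw [mul_add, ← C_mul]; congr 2; ring]
    exact mul_ne_zero (by simp) (X_add_C_ne_zero _)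

/-- `normT ≠ 0`. [cite: Zudilin2014ZetaTwo, Section 6 (definition of R̂)] -/
theorem normT_ne_zero (a b : Fin 4 → ℤ) : normT a b ≠ 0 := by
  unfold normT facZ; positivity

/-- `deg numT = (â₀−b̂₀) + (â₁−b̂₁)`. [cite: Zudilin2014ZetaTwo, Section 6 (definition of R̂)] -/
theorem natDegree_numT (a b : Fin 4 → ℤ) :
    (numT a b).natDegree = (a 0 - b 0).toNat + (a 1 - b 1).toNat := by
  unfold numT
  rw [natDegree_C_mul (normT_ne_zero a b), natDegree_mul (by
      unfold block2; exact prod_ne_zero_iff.2 fun l _ => by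
        rw [show C (2 : ℚ) * X + C (l : ℚ) = C (2 : ℚ) * (X + C ((l : ℚ) / 2)) by
          rw [mul_add, ← C_mul]; congr 2; ring]
        exact mul_ne_zero (by simp) (X_add_C_ne_zero _)) (block_ne_zero _ _),
    natDegree_block2, natDegree_block]

/-- `deg numT + 2 = deg denT` under the balance `Σ â = Σ b̂ − 2`. [cite: Zudilin2014ZetaTwo, Section 6, eq. (cond2)] -/
theorem natDegree_numT_add_two (hab : AdmissibleT a b) :
    (numT a b).natDegree + 2 = (denT a b).natDegree := by
  rw [natDegree_numT, natDegree_denT]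
  have h := hab.balance
  simp only [Fin.sum_univ_four] at h
  have h0 := hab.b0_le_a0
  have h1 := hab.b1_le 1 (by decide)
  have h2 := (hab.a_lt 2 (by decide)).1
  have h3 := (hab.a_lt 3 (by decide)).2
  omega

/-! ### Evaluations of `dhatT_j` at the poles -/

/-- `dhatT_k(−k) ≠ 0` (all its factors are `(X + i)`, `i ≠ k`). [cite: Zudilin2014ZetaTwo, Section 6, eq. (T2)] -/
theorem eval_dhatT_self_ne_zero (a b : Fin 4 → ℤ) (k : ℤ) : (dhatT a b k).eval (-(k : ℚ)) ≠ 0 := by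
  unfold dhatT
  rw [eval_mul, eval_prod, eval_prod]
  refine mul_ne_zero (prod_ne_zero_iff.2 fun i hi => ?_) (prod_ne_zero_iff.2 fun i hi => ?_) <;>
  · have hik := ne_of_mem_erase hi
    simp only [eval_add, eval_X, eval_C]
    have : (-(k : ℚ) + i) = ((i - k : ℤ) : ℚ) := by push_cast; ring
    rw [this]; exact_mod_cast sub_ne_zero.2 hik

/-- For `j ≠ k` with `k` a pole, `(X+k)^{μ_k} ∣ dhatT_j`. [cite: Zudilin2014ZetaTwo, Section 6, eq. (T2)] -/
theorem pow_dvd_dhatT_of_ne {j k : ℤ} (hjk : j ≠ k) :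
    (X + C (k : ℚ)) ^ multT a b k ∣ dhatT a b j := by
  unfold dhatT multT
  have d2 : (X + C (k : ℚ)) ^ (if k ∈ Ico (a 2) (b 2) then 1 else 0) ∣
      ∏ i ∈ (Ico (a 2) (b 2)).erase j, (X + C (i : ℚ)) := by
    split_ifs with h
    · rw [pow_one]; exact dvd_prod_of_mem _ (mem_erase.2 ⟨hjk.symm, h⟩)
    · simp
  have d3 : (X + C (k : ℚ)) ^ (if k ∈ Ico (a 3) (b 3) then 1 else 0) ∣
      ∏ i ∈ (Ico (a 3) (b 3)).erase j, (X + C (i : ℚ)) := by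
    split_ifs with h
    · rw [pow_one]; exact dvd_prod_of_mem _ (mem_erase.2 ⟨hjk.symm, h⟩)
    · simp
  rw [pow_add]; exact mul_dvd_mul d2 d3

/-- A polynomial divisible by `(X+k)^μ` with `1 ≤ μ` vanishes at `−k`. [cite: Zudilin2014ZetaTwo, Section 6, eq. (T2)] -/
theorem eval_eq_zero_of_pow_dvd {f : ℚ[X]} {k : ℤ} {m : ℕ} (hm : 1 ≤ m) (h : (X + C (k : ℚ)) ^ m ∣ f) :
    f.eval (-(k : ℚ)) = 0 := by
  obtain ⟨g, rfl⟩ := h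
  rw [eval_mul, eval_pow, eval_add, eval_X, eval_C, neg_add_cancel, zero_pow (by omega), zero_mul]

/-- A polynomial divisible by `(X+k)²` has derivative vanishing at `−k`. [cite: Zudilin2014ZetaTwo, Section 6, eq. (T2)] -/
theorem eval_derivative_eq_zero_of_sq_dvd {f : ℚ[X]} {k : ℤ} (h : (X + C (k : ℚ)) ^ 2 ∣ f) :
    (derivative f).eval (-(k : ℚ)) = 0 := by
  obtain ⟨g, rfl⟩ := h
  simp only [derivative_mul, derivative_pow, derivative_add, derivative_X, derivative_C, add_zero,
    Nat.cast_ofNat, eval_add, eval_mul, eval_pow, eval_X, eval_C, neg_add_cancel]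
  norm_num

/-! ### The correction polynomial `Ψ` -/

/-- The polar numerator at `k`: `(A_k + B_k (X+k)^{μ_k−1})·dhatT_k`. [cite: Zudilin2014ZetaTwo, Section 6, display before eq. (T2)] -/
def polarNum (a b : Fin 4 → ℤ) (k : ℤ) : ℚ[X] :=
  (C (coefAT a b k) + C (coefBT a b k) * (X + C (k : ℚ)) ^ (multT a b k - 1)) * dhatT a b k

/-- `Ψ = numT − Σ_{k ∈ poles} polarNum_k`. [cite: Zudilin2014ZetaTwo, Section 6, display before eq. (T2)] -/
def psiPoly (a b : Fin 4 → ℤ) : ℚ[X] := numT a b - ∑ k ∈ poleSet a b, polarNum a b k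

/-- `A_k = 0` at a simple pole (`qpolyT = numT·(X+k)` vanishes at `−k`). [cite: Zudilin2014ZetaTwo, Section 6, eq. (T2)] -/
theorem coefAT_of_simple {k : ℤ} (hm : multT a b k = 1) : coefAT a b k = 0 := by
  unfold coefAT qpolyT; rw [hm]
  simp [eval_mul]

/-- `deg polarNum_k ≤ deg denT − 1` on the pole set. [cite: Zudilin2014ZetaTwo, Section 6, eq. (T2)] -/
theorem natDegree_polarNum_le {k : ℤ} (hk : k ∈ poleSet a b) :
    (polarNum a b k).natDegree ≤ (denT a b).natDegree - 1 := by
  have hμ := one_le_multT_of_mem hk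
  have hμ2 := multT_le_two a b k
  have hd := natDegree_dhatT_add a b k
  unfold polarNum
  refine (natDegree_mul_le).trans ?_
  have h1 : (C (coefAT a b k) + C (coefBT a b k) * (X + C (k : ℚ)) ^ (multT a b k - 1)).natDegree
      ≤ multT a b k - 1 := by
    refine (natDegree_add_le _ _).trans (max_le (by simp) ?_)
    refine (natDegree_mul_le).trans ?_
    rw [natDegree_C, zero_add]
    exact (natDegree_pow_le).trans (by rw [natDegree_X_add_C, mul_one])
  omega

/-- `deg Ψ ≤ deg denT − 1`. [cite: Zudilin2014ZetaTwo, Section 6, eq. (T2)] -/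
theorem natDegree_psiPoly_le (hab : AdmissibleT a b) :
    (psiPoly a b).natDegree ≤ (denT a b).natDegree - 1 := by
  unfold psiPoly
  refine (natDegree_sub_le _ _).trans (max_le ?_ ?_)
  · have := natDegree_numT_add_two hab; omega
  · exact natDegree_sum_le_of_forall_le (poleSet a b) (polarNum a b) fun k hk => natDegree_polarNum_le hk

/-- `Ψ(−k) = 0` at every pole. [cite: Zudilin2014ZetaTwo, Section 6, eq. (T2)] -/
theorem eval_psiPoly_eq_zero {k : ℤ} (hk : k ∈ poleSet a b) : (psiPoly a b).eval (-(k : ℚ)) = 0 := by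
  have hμ := one_le_multT_of_mem hk
  have hμ2 := multT_le_two a b k
  have hD := eval_dhatT_self_ne_zero a b k
  unfold psiPoly
  rw [eval_sub, eval_finsetSum, ← Finset.add_sum_erase _ _ hk]
  have hrest : ∑ j ∈ (poleSet a b).erase k, (polarNum a b j).eval (-(k : ℚ)) = 0 := by
    refine sum_eq_zero fun j hj => ?_
    have hjk := ne_of_mem_erase hj
    unfold polarNum
    rw [eval_mul, eval_eq_zero_of_pow_dvd hμ (pow_dvd_dhatT_of_ne hjk), mul_zero]
  rw [hrest, add_zero]
  unfold polarNum
  rcases (show multT a b k = 1 ∨ multT a b k = 2 by omega) with h1 | h2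
  · -- simple pole: A_k = 0, B_k = numT(−k)/dhatT(−k)
    rw [coefAT_of_simple h1, coefBT_of_simple h1, h1]
    simp only [Nat.sub_self, pow_zero, mul_one, map_zero, zero_add, eval_mul, eval_C]
    rw [div_mul_cancel₀ _ hD, sub_self]
  · -- double pole: the B-term vanishes at −k, A_k dhatT(−k) = numT(−k)
    rw [h2]
    simp only [show (2 : ℕ) - 1 = 1 from rfl, pow_one, eval_mul, eval_add, eval_C, eval_X,
      neg_add_cancel, mul_zero, add_zero]
    unfold coefAT qpolyT
    rw [h2]
    simp only [Nat.sub_self, pow_zero, mul_one]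
    rw [div_mul_cancel₀ _ hD, sub_self]

/-- `Ψ′(−k) = 0` at every double pole (the quotient rule defining `B_k`). [cite: Zudilin2014ZetaTwo, Section 6, after eq. (T2)] -/
theorem eval_derivative_psiPoly_eq_zero {k : ℤ} (hk : k ∈ poleSet a b) (h2 : multT a b k = 2) :
    (derivative (psiPoly a b)).eval (-(k : ℚ)) = 0 := by
  have hD := eval_dhatT_self_ne_zero a b k
  unfold psiPoly
  rw [derivative_sub, derivative_sum, eval_sub, eval_finsetSum, ← Finset.add_sum_erase _ _ hk]
  have hrest : ∑ j ∈ (poleSet a b).erase k, (derivative (polarNum a b j)).eval (-(k : ℚ)) = 0 := by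
    refine sum_eq_zero fun j hj => ?_
    have hjk := ne_of_mem_erase hj
    have hdvd : (X + C (k : ℚ)) ^ 2 ∣ polarNum a b j := by
      unfold polarNum; rw [← h2]; exact (pow_dvd_dhatT_of_ne hjk).mul_left _
    exact eval_derivative_eq_zero_of_sq_dvd hdvd
  rw [hrest, add_zero]
  -- the k-term: derivative of (C A + C B (X+k)) * dhat at −k = A·dhat′(−k) + B·dhat(−k)
  have hk_term : (derivative (polarNum a b k)).eval (-(k : ℚ)) =
      coefAT a b k * (derivative (dhatT a b k)).eval (-(k : ℚ)) + coefBT a b k * (dhatT a b k).eval (-(k : ℚ)) := by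
    unfold polarNum; rw [h2]
    simp only [show (2 : ℕ) - 1 = 1 from rfl, pow_one, derivative_mul, derivative_add, derivative_C,
      derivative_X, zero_add, mul_one, add_zero, eval_add, eval_mul, eval_C, eval_X, neg_add_cancel,
      mul_zero, zero_mul]
    ring
  rw [hk_term]
  -- numT′(−k) − A dhat′(−k) − B dhat(−k) = 0 by the quotient rule
  have hB : coefBT a b k * (dhatT a b k).eval (-(k : ℚ)) ^ 2 =
      (derivative (numT a b)).eval (-(k : ℚ)) * (dhatT a b k).eval (-(k : ℚ))
        - (numT a b).eval (-(k : ℚ)) * (derivative (dhatT a b k)).eval (-(k : ℚ)) := by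
    unfold coefBT qpolyT; rw [h2]
    simp only [Nat.sub_self, pow_zero, mul_one]
    rw [div_mul_cancel₀ _ (pow_ne_zero 2 hD)]
  have hA : coefAT a b k * (dhatT a b k).eval (-(k : ℚ)) = (numT a b).eval (-(k : ℚ)) := by
    unfold coefAT qpolyT; rw [h2]
    simp only [Nat.sub_self, pow_zero, mul_one]
    rw [div_mul_cancel₀ _ hD]
  -- multiply the goal by dhat(−k) ≠ 0
  have key : ((derivative (numT a b)).eval (-(k : ℚ)) -
      (coefAT a b k * (derivative (dhatT a b k)).eval (-(k : ℚ))
        + coefBT a b k * (dhatT a b k).eval (-(k : ℚ)))) * (dhatT a b k).eval (-(k : ℚ)) = 0 := by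
    have e : ((derivative (numT a b)).eval (-(k : ℚ)) -
        (coefAT a b k * (derivative (dhatT a b k)).eval (-(k : ℚ))
          + coefBT a b k * (dhatT a b k).eval (-(k : ℚ)))) * (dhatT a b k).eval (-(k : ℚ))
        = (derivative (numT a b)).eval (-(k : ℚ)) * (dhatT a b k).eval (-(k : ℚ))
          - (coefAT a b k * (dhatT a b k).eval (-(k : ℚ))) * (derivative (dhatT a b k)).eval (-(k : ℚ))
          - coefBT a b k * (dhatT a b k).eval (-(k : ℚ)) ^ 2 := by ring
    rw [e, hA, hB]; ring
  rcases mul_eq_zero.1 key with h | h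
  · exact h
  · exact absurd h hD

/-- `(X+k)^{μ_k} ∣ Ψ` at every pole. [cite: Zudilin2014ZetaTwo, Section 6, eq. (T2)] -/
theorem pow_multT_dvd_psiPoly {k : ℤ} (hk : k ∈ poleSet a b) :
    (X + C (k : ℚ)) ^ multT a b k ∣ psiPoly a b := by
  by_cases h0 : psiPoly a b = 0
  · rw [h0]; exact dvd_zero _
  have hμ := one_le_multT_of_mem hk
  have hμ2 := multT_le_two a b k
  have e : (X + C (k : ℚ)) = X - C (-(k : ℚ)) := by simp
  rw [e, ← le_rootMultiplicity_iff h0]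
  rcases (show multT a b k = 1 ∨ multT a b k = 2 by omega) with h1 | h2
  · rw [h1, Nat.one_le_iff_ne_zero, ← Nat.pos_iff_ne_zero, rootMultiplicity_pos h0]
    exact eval_psiPoly_eq_zero hk
  · rw [h2]
    exact (one_lt_rootMultiplicity_iff_isRoot h0).2
      ⟨eval_psiPoly_eq_zero hk, eval_derivative_psiPoly_eq_zero hk h2⟩

/-- `∏_{k ∈ poles} (X+k)^{μ_k} = denT`. [cite: Zudilin2014ZetaTwo, Section 6 (poles of R̂)] -/
theorem prod_pow_multT_eq_denT (a b : Fin 4 → ℤ) :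
    ∏ k ∈ poleSet a b, (X + C (k : ℚ)) ^ multT a b k = denT a b := by
  unfold multT denT block
  simp_rw [pow_add, prod_mul_distrib, pow_ite, pow_one, pow_zero, ← prod_filter, filter_mem_eq_inter]
  rw [show poleSet a b ∩ Ico (a 2) (b 2) = Ico (a 2) (b 2) from inter_eq_right.2 subset_union_left,
    show poleSet a b ∩ Ico (a 3) (b 3) = Ico (a 3) (b 3) from inter_eq_right.2 subset_union_right]

/-- **`Ψ = 0`.** [cite: Zudilin2014ZetaTwo, Section 6, display before eq. (T2)] -/
theorem psiPoly_eq_zero (hab : AdmissibleT a b) : psiPoly a b = 0 := by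
  by_contra h0
  have hdvd : denT a b ∣ psiPoly a b := by
    rw [← prod_pow_multT_eq_denT]
    refine Finset.prod_dvd_of_coprime (fun i _ j _ hij => ?_) fun k hk => pow_multT_dvd_psiPoly hk
    have e : ∀ m : ℤ, (X + C (m : ℚ)) = X - C (-(m : ℚ)) := fun m => by simp
    change IsCoprime ((X + C (i : ℚ)) ^ multT a b i) ((X + C (j : ℚ)) ^ multT a b j)
    rw [e, e]
    exact (isCoprime_X_sub_C_of_isUnit_sub (by
      rw [neg_sub_neg]; exact (sub_ne_zero.2 (by exact_mod_cast hij.symm)).isUnit)).pow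
  have h1 := natDegree_le_of_dvd hdvd h0
  have h2 := natDegree_psiPoly_le hab
  have h3 : 1 ≤ (denT a b).natDegree := by
    rw [natDegree_denT]; have := (hab.a_lt 2 (by decide)).1; omega
  omega

end Literature.NumberTheory.Irrationality.Zudilin2014

end
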